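import Mathlib.Analysis.Complex.JensenFormula
import Mathlib.Analysis.Complex.BorelCaratheodory
import Mathlib.Analysis.Complex.CanonicalDecomposition
import Mathlib.Analysis.Complex.HasPrimitives
import Mathlib.Analysis.Complex.AbsMax
import Mathlib.Analysis.Complex.CauchyIntegral
import Mathlib.Analysis.SpecialFunctions.Log.Summable
import Mathlib.Algebra.Order.Field.GeomSum
import Literature.Analysis.Complex.HadamardGenusZero
import Literature.Analysis.Complex.LogDerivZeros
import HarnessLib

/-!
# Hadamard's factorisation theorem in genus zero — proofs

Discharges the named fact `Literature.Analysis.Complex.hadamard_genus_zero`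
(`Literature/Analysis/Complex/HadamardGenusZero.lean`, [Conway 1978, Ch. XI, Thm. 3.4] in genus
`0`): an entire `f` with `‖f z‖ ≤ C exp (‖z‖ ^ ρ)`, `ρ < 1`, `f 0 ≠ 0` satisfies
`f z / f 0 = ∏ₙ (1 - bₙ z)` with `Σ ‖bₙ‖ < ∞`, the `bₙ` being the inverses of the zeros of `f`
(with multiplicity, padded with zeros).

## Proof

A variant of Conway's argument [Conway 1978, Ch. XI, Lemma 3.1 and Thm. 3.4]: Poisson–Jensen /
Blaschke factors `(R² - ā z)/(R (z - a))` at a radius `R`, then `R → ∞`; here the Borel–Carathéodory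
inequality replaces Conway's differentiated Poisson integral, so that no estimate of canonical
products from below is needed.

1. Jensen's inequality (`AnalyticOnNhd.sum_divisor_le`, Mathlib) bounds the number `n(r)` of zeros
   in `|z| ≤ r` by `O(r ^ ρ)`; a dyadic decomposition gives `Σ 1/|aₙ| < ∞`.
2. For a radius `R` with no zeros on `|z| = R`, Mathlib's canonical (Blaschke) decomposition
   `MeromorphicOn.exists_ecanonicalDecomp` writes `f = B · h` on `|z| ≤ R` with `|B| = 1` on
   `|z| = R` and `h` zero-free; `h = h(0) exp φ` with `φ` a primitive of `h'/h`
   (`Literature.Analysis.Complex.exists_log_on_ball` of `LogDerivZeros.lean`), `Re φ ≤ log M(R) - log |f 0|` by the maximum principle,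
   and the Borel–Carathéodory theorem (`Complex.borelCaratheodory_zero`) gives
   `|φ(z)| ≤ 4 (log M(R) - log|f 0|) |z| / R → 0` (`ρ < 1`).
3. Unwinding `B(z)/B(0) = ∏_{|a| < R} (1 - z/a) / (1 - ā z / R²)` and letting `R → ∞` through
   zero-free radii gives `∏_{|a|<R} (1 - z/a) → f z / f 0`; absolute convergence upgrades this to
   Mathlib's unconditional `HasProd`.

## Main statements

* `Literature.Analysis.Complex.hadamard_genus_zero_zeros` — strong form: the `bₙ ≠ 0` are exactly the inverses of
  the zeros of `f`, each zero `a` occurring `analyticOrderNatAt f a` times.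
* `Literature.Complex.hadamard_genus_zero_holds : hadamard_genus_zero`.

## References

* J. B. Conway, *Functions of One Complex Variable I*, 2nd ed., GTM 11, Springer 1978, Ch. XI
  Lemma 3.1 and Thm. 3.4 (pp. 280–282). [cite: Conway1978, Ch. XI Thm. 3.4]
-/

noncomputable section

open Complex Metric Filter Topology Set MeromorphicOn

namespace Literature.Analysis.Complex

namespace HadamardGenusZero

variable {f : ℂ → ℂ}

/-! ### Zeros of an entire function with `f 0 ≠ 0` -/

/-- An entire function is analytic on a neighbourhood of every set. [folklore] -/
theorem analyticOnNhd_of_entire (hf : Differentiable ℂ f) (s : Set ℂ) : AnalyticOnNhd ℂ f s :=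
  fun z _ => hf.analyticAt z

/-- An entire `f` with `f 0 ≠ 0` has finite vanishing order everywhere. [folklore] -/
theorem analyticOrderAt_ne_top (hf : Differentiable ℂ f) (h0 : f 0 ≠ 0) (u : ℂ) :
    analyticOrderAt f u ≠ ⊤ := by
  intro h
  rw [analyticOrderAt_eq_top] at h
  have := (analyticOnNhd_univ_iff_differentiable.mpr hf).eqOn_zero_of_preconnected_of_eventuallyEq_zero
    isPreconnected_univ (mem_univ u) h
  exact h0 (this (mem_univ 0))

/-- An entire `f` with `f 0 ≠ 0` has finite meromorphic order everywhere. [folklore] -/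
theorem meromorphicOrderAt_ne_top (hf : Differentiable ℂ f) (h0 : f 0 ≠ 0) (u : ℂ) :
    meromorphicOrderAt f u ≠ ⊤ := by
  rw [(hf.analyticAt u).meromorphicOrderAt_eq]
  cases h : analyticOrderAt f u with
  | top => exact absurd h (analyticOrderAt_ne_top hf h0 u)
  | coe n => simp

/-- The vanishing order as a natural number: Mathlib's `analyticOrderNatAt f u`, the multiplicity
of `u` as a zero of `f` (zero if `f u ≠ 0`). [folklore] -/
theorem analyticOrderAt_eq_analyticOrderNatAt (hf : Differentiable ℂ f) (h0 : f 0 ≠ 0) (u : ℂ) :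
    analyticOrderAt f u = analyticOrderNatAt f u :=
  (Nat.cast_analyticOrderNatAt (analyticOrderAt_ne_top hf h0 u)).symm

/-- `analyticOrderNatAt f u ≠ 0 ↔ f u = 0`. [folklore] -/
theorem analyticOrderNatAt_ne_zero_iff (hf : Differentiable ℂ f) (h0 : f 0 ≠ 0) (u : ℂ) :
    analyticOrderNatAt f u ≠ 0 ↔ f u = 0 := by
  have h := (hf.analyticAt u).analyticOrderAt_eq_zero
  rw [analyticOrderAt_eq_analyticOrderNatAt hf h0 u] at h
  constructor
  · intro hm
    by_contra hfu
    exact hm (by exact_mod_cast h.mpr hfu)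
  · intro hfu hm
    exact (h.mp (by exact_mod_cast hm)) hfu

/-- `analyticOrderNatAt f u = 0 ↔ f u ≠ 0`. [folklore] -/
theorem analyticOrderNatAt_eq_zero_iff (hf : Differentiable ℂ f) (h0 : f 0 ≠ 0) (u : ℂ) :
    analyticOrderNatAt f u = 0 ↔ f u ≠ 0 := by
  have := analyticOrderNatAt_ne_zero_iff hf h0 u
  tauto

/-- `analyticOrderNatAt f 0 = 0` since `f 0 ≠ 0`. [folklore] -/
theorem analyticOrderNatAt_zero (hf : Differentiable ℂ f) (h0 : f 0 ≠ 0) : analyticOrderNatAt f 0 = 0 :=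
  (analyticOrderNatAt_eq_zero_iff hf h0 0).mpr h0

/-- The divisor of `f` on any set `U` is the multiplicity function (restricted to `U`). [folklore] -/
theorem divisor_apply_eq (hf : Differentiable ℂ f) (h0 : f 0 ≠ 0) (U : Set ℂ) {u : ℂ}
    (hu : u ∈ U) : divisor f U u = (analyticOrderNatAt f u : ℤ) := by
  rw [(analyticOnNhd_of_entire hf U).divisor_apply hu, analyticOrderAt_eq_analyticOrderNatAt hf h0 u]
  simp

/-- The divisor vanishes off `U`. [folklore] -/
theorem divisor_apply_of_not_mem (U : Set ℂ) {u : ℂ} (hu : u ∉ U) : divisor f U u = 0 :=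
  Function.locallyFinsuppWithin.apply_eq_zero_of_notMem _ hu

/-- The zeros of `f` in the closed ball of radius `R`, a finite set. [folklore] -/
theorem finite_zeros (hf : Differentiable ℂ f) (h0 : f 0 ≠ 0) (R : ℝ) :
    {u : ℂ | ‖u‖ ≤ R ∧ f u = 0}.Finite := by
  have h := (divisor f (closedBall (0 : ℂ) R)).finiteSupport (isCompact_closedBall 0 R)
  refine h.subset ?_
  intro u hu
  simp only [mem_setOf_eq] at hu
  rw [Function.mem_support, divisor_apply_eq hf h0 _ (mem_closedBall_zero_iff.mpr hu.1)]
  exact_mod_cast (analyticOrderNatAt_ne_zero_iff hf h0 u).mpr hu.2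

/-- The finite set of zeros of `f` in `‖u‖ ≤ R`. [folklore] -/
def zerosIn (hf : Differentiable ℂ f) (h0 : f 0 ≠ 0) (R : ℝ) : Finset ℂ :=
  (finite_zeros hf h0 R).toFinset

/-- Membership in `zerosIn f R`: zeros of `f` of norm `≤ R`. [folklore] -/
theorem mem_zerosIn (hf : Differentiable ℂ f) (h0 : f 0 ≠ 0) {R : ℝ} {u : ℂ} :
    u ∈ zerosIn hf h0 R ↔ ‖u‖ ≤ R ∧ f u = 0 := by
  simp [zerosIn]

/-- `0` is not a zero. [folklore] -/
theorem zero_not_mem_zerosIn (hf : Differentiable ℂ f) (h0 : f 0 ≠ 0) (R : ℝ) :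
    (0 : ℂ) ∉ zerosIn hf h0 R := by
  rw [mem_zerosIn]; exact fun h => h0 h.2

/-- Zeros have positive norm. [folklore] -/
theorem norm_pos_of_mem_zerosIn (hf : Differentiable ℂ f) (h0 : f 0 ≠ 0) {R : ℝ} {u : ℂ}
    (hu : u ∈ zerosIn hf h0 R) : 0 < ‖u‖ := by
  rw [norm_pos_iff]; rintro rfl; exact zero_not_mem_zerosIn hf h0 R hu

/-- `zerosIn f R` is monotone in `R`. [folklore] -/
theorem zerosIn_mono (hf : Differentiable ℂ f) (h0 : f 0 ≠ 0) {R R' : ℝ} (h : R ≤ R') :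
    zerosIn hf h0 R ⊆ zerosIn hf h0 R' := by
  intro u hu
  rw [mem_zerosIn] at hu ⊢
  exact ⟨hu.1.trans h, hu.2⟩

/-- The zero-counting function `n(R) = Σ_{|u| ≤ R} analyticOrderNatAt f u`. [folklore] -/
def count (hf : Differentiable ℂ f) (h0 : f 0 ≠ 0) (R : ℝ) : ℕ :=
  ∑ u ∈ zerosIn hf h0 R, analyticOrderNatAt f u

/-- The counting function `n(R)` is monotone. [folklore] -/
theorem count_mono (hf : Differentiable ℂ f) (h0 : f 0 ≠ 0) {R R' : ℝ} (h : R ≤ R') :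
    count hf h0 R ≤ count hf h0 R' :=
  Finset.sum_le_sum_of_subset (zerosIn_mono hf h0 h)

/-- The finsum of the divisor on a closed ball is the counting function. [folklore] -/
theorem finsum_divisor_closedBall (hf : Differentiable ℂ f) (h0 : f 0 ≠ 0) (R : ℝ) :
    ∑ᶠ u, divisor f (closedBall (0 : ℂ) R) u = (count hf h0 R : ℤ) := by
  rw [finsum_eq_sum_of_support_subset _ (s := zerosIn hf h0 R)]
  · rw [count, Nat.cast_sum]
    refine Finset.sum_congr rfl fun u hu => ?_
    rw [mem_zerosIn] at hu
    exact divisor_apply_eq hf h0 _ (mem_closedBall_zero_iff.mpr hu.1)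
  · intro u hu
    rw [Function.mem_support] at hu
    simp only [Finset.mem_coe, mem_zerosIn]
    by_cases hU : u ∈ closedBall (0 : ℂ) R
    · rw [divisor_apply_eq hf h0 _ hU] at hu
      exact ⟨mem_closedBall_zero_iff.mp hU, (analyticOrderNatAt_ne_zero_iff hf h0 u).mp (by exact_mod_cast hu)⟩
    · exact absurd (divisor_apply_of_not_mem _ hU) hu

/-- **Jensen's inequality** for the counting function: if `‖f‖ ≤ M` on `|z| = 2r` (`M ≥ 1`) then
`n(r) ≤ log (M / ‖f 0‖) / log 2`. [folklore] -/
theorem count_le_of_bound (hf : Differentiable ℂ f) (h0 : f 0 ≠ 0) {r M : ℝ} (hr : 0 < r)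
    (hM : 1 ≤ M) (hb : ∀ z : ℂ, ‖z‖ = 2 * r → ‖f z‖ ≤ M) :
    (count hf h0 r : ℝ) ≤ Real.log (M / ‖f 0‖) / Real.log 2 := by
  have h1 : 0 < |r| := by rw [abs_of_pos hr]; exact hr
  have h2 : |r| < |2 * r| := by rw [abs_of_pos hr, abs_of_pos (by linarith)]; linarith
  have key := AnalyticOnNhd.sum_divisor_le (c := 0) (f := f) h1 h2 hM
    (analyticOnNhd_of_entire hf _) h0 (fun z hz => hb z (by
      rw [mem_sphere_zero_iff_norm, abs_of_pos (by linarith)] at hz; exact hz))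
  rw [abs_of_pos hr, finsum_divisor_closedBall hf h0 r] at key
  have h3 : Real.log (2 * r / r) = Real.log 2 := by rw [mul_div_assoc, div_self hr.ne', mul_one]
  rw [h3] at key
  exact_mod_cast key

/-- Zero-free radii exist in every interval `[R₀, 2 R₀]`. [folklore] -/
theorem exists_good_radius (hf : Differentiable ℂ f) (h0 : f 0 ≠ 0) {R₀ : ℝ} (hR₀ : 0 < R₀) :
    ∃ R, R₀ ≤ R ∧ R ≤ 2 * R₀ ∧ ∀ u : ℂ, ‖u‖ = R → f u ≠ 0 := by
  have hinf : (Icc R₀ (2 * R₀)).Infinite := Icc_infinite (by linarith)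
  obtain ⟨R, hR, hRn⟩ := hinf.exists_notMem_finset ((zerosIn hf h0 (2 * R₀)).image (‖·‖))
  refine ⟨R, hR.1, hR.2, fun u hu hfu => hRn ?_⟩
  rw [Finset.mem_image]
  exact ⟨u, (mem_zerosIn hf h0).mpr ⟨hu ▸ hR.2, hfu⟩, hu⟩


/-! ### Pointwise identities from identities modulo codiscrete sets -/

/-- Two functions on `ℂ` that agree on a codiscrete subset of a closed ball of positive radius and
are both continuous at a point `z` of the ball agree at `z`. [folklore] -/
theorem eq_of_eventuallyEq_codiscreteWithin {F G : ℂ → ℂ} {R : ℝ} (hR : 0 < R)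
    (hFG : F =ᶠ[codiscreteWithin (closedBall (0 : ℂ) R)] G) {z : ℂ} (hz : ‖z‖ ≤ R)
    (hF : ContinuousAt F z) (hG : ContinuousAt G z) : F z = G z := by
  -- an auxiliary point `c ≠ z` of the open ball
  obtain ⟨c, hc, hcz⟩ : ∃ c : ℂ, ‖c‖ < R ∧ c ≠ z := by
    by_cases h : z = 0
    · refine ⟨(R / 2 : ℝ), ?_, ?_⟩
      · rw [Complex.norm_real, Real.norm_eq_abs, abs_of_pos (by positivity)]; linarith
      · rw [h]; intro h'
        have : (R / 2 : ℝ) = 0 := by exact_mod_cast h'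
        linarith
    · exact ⟨0, by simpa using hR, fun h' => h h'.symm⟩
  -- the segment `γ t = z + t (c - z)`, `t ∈ (0, 1]`, lies in the ball, avoids `z`, tends to `z`
  set γ : ℝ → ℂ := fun t => z + (t : ℂ) * (c - z) with hγ
  have hγ0 : Tendsto γ (𝓝[>] 0) (𝓝 z) := by
    have : Continuous γ := by rw [hγ]; fun_prop
    have h1 := this.tendsto 0
    simp only [hγ, Complex.ofReal_zero, zero_mul, add_zero] at h1
    exact h1.mono_left nhdsWithin_le_nhds
  have hγne : ∀ t : ℝ, 0 < t → γ t ≠ z := by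
    intro t ht h
    have : (t : ℂ) * (c - z) = 0 := by
      have := congrArg (· - z) h; simpa [hγ] using this
    rcases mul_eq_zero.mp this with h1 | h1
    · exact ht.ne' (by exact_mod_cast h1)
    · exact hcz (sub_eq_zero.mp h1)
  have hγin : ∀ t : ℝ, 0 < t → t ≤ 1 → ‖γ t‖ < R := by
    intro t ht ht1
    have : γ t = ((1 - t : ℝ) : ℂ) * z + (t : ℂ) * c := by
      simp only [hγ, Complex.ofReal_sub, Complex.ofReal_one]; ring
    rw [this]
    calc ‖((1 - t : ℝ) : ℂ) * z + (t : ℂ) * c‖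
        ≤ ‖((1 - t : ℝ) : ℂ) * z‖ + ‖(t : ℂ) * c‖ := norm_add_le _ _
      _ = (1 - t) * ‖z‖ + t * ‖c‖ := by
          rw [norm_mul, norm_mul, Complex.norm_real, Complex.norm_real, Real.norm_eq_abs,
            Real.norm_eq_abs, abs_of_nonneg (by linarith), abs_of_pos ht]
      _ < (1 - t) * R + t * R := by
          have h1 : (1 - t) * ‖z‖ ≤ (1 - t) * R := mul_le_mul_of_nonneg_left hz (by linarith)
          have h2 : t * ‖c‖ < t * R := mul_lt_mul_of_pos_left hc ht
          linarith
      _ = R := by ring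
  have hγ' : Tendsto γ (𝓝[>] 0) (𝓝[≠] z) := by
    refine tendsto_nhdsWithin_iff.mpr ⟨hγ0, ?_⟩
    filter_upwards [self_mem_nhdsWithin] with t ht
    exact hγne t ht
  -- the agreement set is a punctured neighbourhood of `z`
  have hS : {x | F x = G x} ∪ (closedBall (0 : ℂ) R)ᶜ ∈ 𝓝[≠] z :=
    (mem_codiscreteWithin_iff_forall_mem_nhdsNE.mp hFG) z (mem_closedBall_zero_iff.mpr hz)
  have hev : ∀ᶠ t in 𝓝[>] (0 : ℝ), F (γ t) = G (γ t) := by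
    have h1 : ∀ᶠ t in 𝓝[>] (0 : ℝ), t ≤ 1 := by
      have : Iio (1 : ℝ) ∈ 𝓝 (0 : ℝ) := Iio_mem_nhds one_pos
      filter_upwards [mem_nhdsWithin_of_mem_nhds this] with t ht using le_of_lt ht
    filter_upwards [hγ'.eventually hS, h1, self_mem_nhdsWithin] with t ht ht1 ht0
    rcases ht with h | h
    · exact h
    · exact absurd (mem_closedBall_zero_iff.mpr (hγin t ht0 ht1).le) h
  have hFl : Tendsto (F ∘ γ) (𝓝[>] 0) (𝓝 (F z)) := hF.tendsto.comp hγ0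
  have hGl : Tendsto (G ∘ γ) (𝓝[>] 0) (𝓝 (G z)) := hG.tendsto.comp hγ0
  exact tendsto_nhds_unique_of_eventuallyEq hFl hGl hev

/-! ### The Blaschke factor at a zero-free radius -/

/-- The finite Blaschke-type product `B_R(z) = ∏_{f(u)=0, |u| ≤ R} (canonicalFactor R u z)^{-m(u)}`. [folklore] -/
def blaschke (hf : Differentiable ℂ f) (h0 : f 0 ≠ 0) (R : ℝ) (z : ℂ) : ℂ :=
  ∏ u ∈ zerosIn hf h0 R, (canonicalFactor R u z) ^ (-(analyticOrderNatAt f u : ℤ))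

/-- At a good radius the zeros in the closed disc lie in the open disc. [folklore] -/
theorem norm_lt_of_mem_zerosIn_of_good (hf : Differentiable ℂ f) (h0 : f 0 ≠ 0) {R : ℝ}
    (hgood : ∀ u : ℂ, ‖u‖ = R → f u ≠ 0) {u : ℂ} (hu : u ∈ zerosIn hf h0 R) : ‖u‖ < R := by
  rw [mem_zerosIn] at hu
  exact lt_of_le_of_ne hu.1 fun h => hgood u h hu.2

/-- At a good radius the divisor of `f` on the disc is `analyticOrderNatAt f` restricted to `zerosIn f R`. [folklore] -/
theorem divisor_ball_eq (hf : Differentiable ℂ f) (h0 : f 0 ≠ 0) {R : ℝ}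
    (hgood : ∀ u : ℂ, ‖u‖ = R → f u ≠ 0) (u : ℂ) :
    divisor f (ball (0 : ℂ) R) u = if u ∈ zerosIn hf h0 R then (analyticOrderNatAt f u : ℤ) else 0 := by
  split_ifs with hu
  · exact divisor_apply_eq hf h0 _ (mem_ball_zero_iff.mpr (norm_lt_of_mem_zerosIn_of_good hf h0 hgood hu))
  · by_cases hb : u ∈ ball (0 : ℂ) R
    · rw [divisor_apply_eq hf h0 _ hb]
      rw [mem_zerosIn, not_and] at hu
      have : analyticOrderNatAt f u = 0 := (analyticOrderNatAt_eq_zero_iff hf h0 u).mpr (hu (mem_ball_zero_iff.mp hb).le)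
      simp [this]
    · exact divisor_apply_of_not_mem _ hb

/-- At a good radius the divisor vanishes on the circle. [folklore] -/
theorem divisor_sphere_eq_zero (hf : Differentiable ℂ f) (h0 : f 0 ≠ 0) {R : ℝ}
    (hgood : ∀ u : ℂ, ‖u‖ = R → f u ≠ 0) (u : ℂ) : divisor f (sphere (0 : ℂ) R) u = 0 := by
  by_cases hu : u ∈ sphere (0 : ℂ) R
  · rw [divisor_apply_eq hf h0 _ hu]
    have : analyticOrderNatAt f u = 0 := (analyticOrderNatAt_eq_zero_iff hf h0 u).mpr (hgood u (mem_sphere_zero_iff_norm.mp hu))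
    simp [this]
  · exact divisor_apply_of_not_mem _ hu

/-- Mathlib's Blaschke finprod is our finite product `blaschke`. [folklore] -/
theorem finprod_canonicalFactor_eq (hf : Differentiable ℂ f) (h0 : f 0 ≠ 0) {R : ℝ}
    (hgood : ∀ u : ℂ, ‖u‖ = R → f u ≠ 0) :
    (∏ᶠ u, canonicalFactor R u ^ (-(divisor f (ball (0 : ℂ) R) u))) = blaschke hf h0 R := by
  have hsupp : Function.mulSupport (fun u => canonicalFactor R u ^ (-(divisor f (ball (0 : ℂ) R) u)))
      ⊆ (zerosIn hf h0 R : Set ℂ) := by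
    intro u hu
    rw [Function.mem_mulSupport] at hu
    by_contra h
    apply hu
    rw [divisor_ball_eq hf h0 hgood u, if_neg (by exact_mod_cast h)]
    simp
  rw [finprod_eq_prod_of_mulSupport_subset _ hsupp]
  funext z
  rw [Finset.prod_apply, blaschke]
  refine Finset.prod_congr rfl fun u hu => ?_
  simp only [Pi.pow_apply]
  rw [divisor_ball_eq hf h0 hgood u, if_pos hu]

/-- The Blaschke factors attached to points of the circle contribute `1`. [folklore] -/
theorem finprod_sphere_eq_one (hf : Differentiable ℂ f) (h0 : f 0 ≠ 0) {R : ℝ}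
    (hgood : ∀ u : ℂ, ‖u‖ = R → f u ≠ 0) :
    (∏ᶠ v, (fun x : ℂ => x - v) ^ (divisor f (sphere (0 : ℂ) R) v)) = 1 := by
  apply finprod_eq_one_of_forall_eq_one
  intro v
  rw [divisor_sphere_eq_zero hf h0 hgood v, zpow_zero]

/-- `blaschke` is analytic away from the zeros of `f`, in the closed ball. [folklore] -/
theorem analyticAt_blaschke (hf : Differentiable ℂ f) (h0 : f 0 ≠ 0) {R : ℝ}
    (hgood : ∀ u : ℂ, ‖u‖ = R → f u ≠ 0) {z : ℂ} (hz : ‖z‖ ≤ R) (hfz : f z ≠ 0) :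
    AnalyticAt ℂ (blaschke hf h0 R) z := by
  unfold blaschke
  apply Finset.analyticAt_fun_prod
  intro u hu
  have huz : z ≠ u := by rintro rfl; exact hfz ((mem_zerosIn hf h0).mp hu).2
  apply AnalyticAt.fun_zpow
  · exact analyticOnNhd_canonicalFactor R u z huz
  · exact canonicalFactor_ne_zero (mem_ball_zero_iff.mpr (norm_lt_of_mem_zerosIn_of_good hf h0 hgood hu))
      (mem_closedBall_zero_iff.mpr hz) huz

/-- `|B(z)| = 1` on `|z| = R`. [cite: Conway1978, Ch. XI Lemma 3.1] -/
theorem norm_blaschke_of_norm_eq (hf : Differentiable ℂ f) (h0 : f 0 ≠ 0) {R : ℝ}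
    (hgood : ∀ u : ℂ, ‖u‖ = R → f u ≠ 0) {z : ℂ} (hz : ‖z‖ = R) : ‖blaschke hf h0 R z‖ = 1 := by
  rw [blaschke, norm_prod]
  refine Finset.prod_eq_one fun u hu => ?_
  rw [norm_zpow, norm_canonicalFactor_eval_circle_eq_one
    (mem_ball_zero_iff.mpr (norm_lt_of_mem_zerosIn_of_good hf h0 hgood hu))
    (mem_sphere_zero_iff_norm.mpr hz), one_zpow]

/-- The canonical factor at `0`: `−R/u`. [folklore] -/
theorem canonicalFactor_apply_zero (R : ℝ) (u : ℂ) : canonicalFactor R u 0 = -(R / u) := by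
  rw [canonicalFactor_apply]
  by_cases hu : u = 0
  · simp [hu]
  by_cases hR : (R : ℂ) = 0
  · simp [hR]
  field_simp
  ring

/-- `|B(0)| ≤ 1`. [folklore] -/
theorem norm_blaschke_zero_le (hf : Differentiable ℂ f) (h0 : f 0 ≠ 0) {R : ℝ} (hR : 0 < R) :
    ‖blaschke hf h0 R 0‖ ≤ 1 := by
  rw [blaschke, norm_prod]
  refine Finset.prod_le_one (fun _ _ => norm_nonneg _) fun u hu => ?_
  have hu0 := norm_pos_of_mem_zerosIn hf h0 hu
  have huR : ‖u‖ ≤ R := ((mem_zerosIn hf h0).mp hu).1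
  rw [canonicalFactor_apply_zero, norm_zpow, norm_neg, norm_div, Complex.norm_real,
    Real.norm_eq_abs, abs_of_pos hR, zpow_neg, zpow_natCast]
  apply inv_le_one_of_one_le₀
  apply one_le_pow₀
  rw [le_div_iff₀ hu0, one_mul]
  exact huR

/-- `B(0) ≠ 0`. [folklore] -/
theorem blaschke_zero_ne_zero (hf : Differentiable ℂ f) (h0 : f 0 ≠ 0) {R : ℝ} (hR : 0 < R) :
    blaschke hf h0 R 0 ≠ 0 := by
  rw [blaschke]
  refine Finset.prod_ne_zero_iff.mpr fun u hu => ?_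
  have hu0 := norm_pos_of_mem_zerosIn hf h0 hu
  rw [canonicalFactor_apply_zero]
  apply zpow_ne_zero
  rw [neg_ne_zero, div_ne_zero_iff]
  exact ⟨by exact_mod_cast hR.ne', norm_pos_iff.mp hu0⟩

/-- The key algebraic identity behind the genus-zero factorisation:
`cF(z)^{-m} / cF(0)^{-m} = (1 - z/u)^m / (1 - ū z / R²)^m`. [folklore] -/
theorem canonicalFactor_zpow_div (R : ℝ) (hR : 0 < R) {u z : ℂ} (hu : u ≠ 0) (huz : z ≠ u)
    (m : ℕ) :
    (canonicalFactor R u z) ^ (-(m : ℤ)) / (canonicalFactor R u 0) ^ (-(m : ℤ))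
      = (1 - z / u) ^ m / (1 - (starRingEnd ℂ) u * z / R ^ 2) ^ m := by
  have hR' : (R : ℂ) ≠ 0 := by exact_mod_cast hR.ne'
  have hzu : z - u ≠ 0 := sub_ne_zero.mpr huz
  rw [canonicalFactor_apply, canonicalFactor_apply_zero, zpow_neg, zpow_neg, zpow_natCast,
    zpow_natCast, inv_div_inv, ← div_pow, ← div_pow]
  congr 1
  field_simp
  ring


/-! ### The decomposition `f = B_R · h` at a zero-free radius -/

/-- At a zero-free radius `R > 0`: a zero-free analytic `h` on the closed ball with `f = B_R · h`
at every point of the closed ball where `f ≠ 0` (Mathlib's extended canonical decomposition,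
upgraded from "modulo a codiscrete set" to a pointwise statement by continuity). [folklore] -/
theorem exists_blaschke_mul (hf : Differentiable ℂ f) (h0 : f 0 ≠ 0) {R : ℝ} (hR : 0 < R)
    (hgood : ∀ u : ℂ, ‖u‖ = R → f u ≠ 0) :
    ∃ h : ℂ → ℂ, AnalyticOnNhd ℂ h (closedBall 0 R) ∧ (∀ u ∈ closedBall (0 : ℂ) R, h u ≠ 0) ∧
      ∀ z : ℂ, ‖z‖ ≤ R → f z ≠ 0 → f z = blaschke hf h0 R z * h z := by
  obtain ⟨h, hD⟩ := MeromorphicOn.exists_ecanonicalDecomp (f := f) (R := R)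
    (analyticOnNhd_of_entire hf _).meromorphicOn (fun u => meromorphicOrderAt_ne_top hf h0 u)
  refine ⟨h, hD.analyticOnNhd, hD.ne_zero, fun z hz hfz => ?_⟩
  have hev := hD.eventuallyEq
  rw [finprod_canonicalFactor_eq hf h0 hgood, finprod_sphere_eq_one hf h0 hgood, mul_one] at hev
  have hB := analyticAt_blaschke hf h0 hgood hz hfz
  have hh := hD.analyticOnNhd z (mem_closedBall_zero_iff.mpr hz)
  have hcont : ContinuousAt (blaschke hf h0 R • h) z := by
    have : ContinuousAt (fun w => blaschke hf h0 R w * h w) z :=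
      hB.continuousAt.mul hh.continuousAt
    exact this
  have := eq_of_eventuallyEq_codiscreteWithin hR hev hz hf.continuous.continuousAt hcont
  simpa using this

/-- Bound for `h` on the closed ball from a bound of `f` on the circle (maximum principle,
`|B_R| = 1` on the circle). [folklore] -/
theorem norm_h_le (hf : Differentiable ℂ f) (h0 : f 0 ≠ 0) {R M : ℝ} (hR : 0 < R)
    (hgood : ∀ u : ℂ, ‖u‖ = R → f u ≠ 0) {h : ℂ → ℂ}
    (hha : AnalyticOnNhd ℂ h (closedBall 0 R))
    (hfe : ∀ z : ℂ, ‖z‖ ≤ R → f z ≠ 0 → f z = blaschke hf h0 R z * h z)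
    (hM : ∀ w : ℂ, ‖w‖ = R → ‖f w‖ ≤ M) {z : ℂ} (hz : ‖z‖ ≤ R) : ‖h z‖ ≤ M := by
  have hcl : closure (ball (0 : ℂ) R) = closedBall 0 R := closure_ball 0 hR.ne'
  have hfr : frontier (ball (0 : ℂ) R) = sphere 0 R := frontier_ball 0 hR.ne'
  refine Complex.norm_le_of_forall_mem_frontier_norm_le isBounded_ball ?_ ?_
    (by rw [hcl]; exact mem_closedBall_zero_iff.mpr hz)
  · refine ⟨(hha.mono ball_subset_closedBall).differentiableOn, ?_⟩
    rw [hcl]; exact hha.continuousOn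
  · intro w hw
    rw [hfr, mem_sphere_zero_iff_norm] at hw
    have hfw := hfe w hw.le (hgood w hw)
    have hB := norm_blaschke_of_norm_eq hf h0 hgood hw
    have : ‖f w‖ = ‖h w‖ := by rw [hfw, norm_mul, hB, one_mul]
    rw [← this]; exact hM w hw

/-- `|f(0)| ≤ M(R)` (maximum modulus). [folklore] -/
theorem norm_f_zero_le (hf : Differentiable ℂ f) (h0 : f 0 ≠ 0) {R : ℝ} (hR : 0 < R)
    {h : ℂ → ℂ} (hfe : ∀ z : ℂ, ‖z‖ ≤ R → f z ≠ 0 → f z = blaschke hf h0 R z * h z) :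
    ‖f 0‖ ≤ ‖h 0‖ := by
  have := hfe 0 (by simpa using hR.le) h0
  rw [this, norm_mul]
  calc ‖blaschke hf h0 R 0‖ * ‖h 0‖ ≤ 1 * ‖h 0‖ :=
        mul_le_mul_of_nonneg_right (norm_blaschke_zero_le hf h0 hR) (norm_nonneg _)
    _ = ‖h 0‖ := one_mul _

/-! ### The partial product at a zero-free radius -/

/-- `1 − ū z / R² ≠ 0` for `|u| ≤ R`, `|z| < R`. [folklore] -/
theorem one_sub_conj_mul_ne_zero {R : ℝ} {u z : ℂ} (hu : ‖u‖ ≤ R) (hz : ‖z‖ < R) :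
    1 - (starRingEnd ℂ) u * z / (R : ℂ) ^ 2 ≠ 0 := by
  have hR : 0 < R := lt_of_le_of_lt (norm_nonneg z) hz
  intro h
  have h1 : (starRingEnd ℂ) u * z / (R : ℂ) ^ 2 = 1 := by linear_combination -h
  have h2 : ‖(starRingEnd ℂ) u * z / (R : ℂ) ^ 2‖ < 1 := by
    rw [norm_div, norm_mul, Complex.norm_conj, norm_pow, Complex.norm_real, Real.norm_eq_abs,
      abs_of_pos hR, div_lt_one (by positivity)]
    calc ‖u‖ * ‖z‖ ≤ R * ‖z‖ := mul_le_mul_of_nonneg_right hu (norm_nonneg z)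
      _ < R * R := mul_lt_mul_of_pos_left hz hR
      _ = R ^ 2 := (sq R).symm
  rw [h1, norm_one] at h2
  exact lt_irrefl _ h2

/-- The genus-zero identity at a zero-free radius `R`: for `|z| < R`, `f z ≠ 0`,
`∏_{|u| ≤ R} (1 - z/u)^{m u} = (f z / f 0) · ∏_{|u| ≤ R} (1 - ū z/R²)^{m u} · e^{-φ}` with
`|φ| ≤ 2 A |z| / (R - |z|)`, `A = max (log M - log |f 0|) 1`, `M` a bound for `|f|` on `|z| = R`. [folklore] -/
theorem partialProduct_eq (hf : Differentiable ℂ f) (h0 : f 0 ≠ 0) {R M : ℝ} (hR : 0 < R)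
    (hgood : ∀ u : ℂ, ‖u‖ = R → f u ≠ 0) (hM : ∀ w : ℂ, ‖w‖ = R → ‖f w‖ ≤ M) {z : ℂ}
    (hz : ‖z‖ < R) (hfz : f z ≠ 0) :
    ∃ φ : ℂ, ‖φ‖ ≤ 2 * (max (Real.log M - Real.log ‖f 0‖) 1) * ‖z‖ / (R - ‖z‖) ∧
      ∏ u ∈ zerosIn hf h0 R, (1 - z / u) ^ analyticOrderNatAt f u =
        f z / f 0 * (∏ u ∈ zerosIn hf h0 R, (1 - (starRingEnd ℂ) u * z / (R : ℂ) ^ 2) ^ analyticOrderNatAt f u)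
          * exp (-φ) := by
  obtain ⟨h, hha, hne, hfe⟩ := exists_blaschke_mul hf h0 hR hgood
  obtain ⟨φ, hφd, hφ0, -, hexp⟩ := exists_log_on_ball
    (hha.mono ball_subset_closedBall).differentiableOn
    (fun w hw => hne w (ball_subset_closedBall hw))
  set A := max (Real.log M - Real.log ‖f 0‖) 1 with hA
  have hApos : 0 < A := lt_of_lt_of_le one_pos (le_max_right _ _)
  have hf0 : 0 < ‖f 0‖ := norm_pos_iff.mpr h0
  have hh0 : ‖f 0‖ ≤ ‖h 0‖ := norm_f_zero_le hf h0 hR hfe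
  have hh0pos : 0 < ‖h 0‖ := hf0.trans_le hh0
  have hMpos : 0 < M := by
    have h1 : ‖((R : ℝ) : ℂ)‖ = R := by
      rw [Complex.norm_real, Real.norm_eq_abs, abs_of_pos hR]
    have h2 := hM (R : ℂ) h1
    have h3 : 0 < ‖f (R : ℂ)‖ := norm_pos_iff.mpr (hgood _ h1)
    linarith
  have hre : ∀ w ∈ ball (0 : ℂ) R, (φ w).re ≤ A := by
    intro w hw
    have h1 := hexp w hw
    have h2 : ‖h w‖ ≤ M := norm_h_le hf h0 hR hgood hha hfe hM (mem_ball_zero_iff.mp hw).le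
    have h3 : ‖h w‖ = ‖h 0‖ * Real.exp (φ w).re := by rw [h1, norm_mul, Complex.norm_exp]
    have h4 : Real.exp (φ w).re ≤ M / ‖f 0‖ := by
      rw [le_div_iff₀ hf0]
      calc Real.exp (φ w).re * ‖f 0‖ ≤ Real.exp (φ w).re * ‖h 0‖ := by gcongr
        _ = ‖h w‖ := by rw [h3, mul_comm]
        _ ≤ M := h2
    calc (φ w).re = Real.log (Real.exp (φ w).re) := (Real.log_exp _).symm
      _ ≤ Real.log (M / ‖f 0‖) := Real.log_le_log (Real.exp_pos _) h4
      _ = Real.log M - Real.log ‖f 0‖ := Real.log_div hMpos.ne' hf0.ne'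
      _ ≤ A := le_max_left _ _
  refine ⟨φ z, Complex.borelCaratheodory_zero hApos hφd hre hR (mem_ball_zero_iff.mpr hz) hφ0, ?_⟩
  have hfz' := hfe z hz.le hfz
  have hf0' := hfe 0 (by simpa using hR.le) h0
  have hexpz := hexp z (mem_ball_zero_iff.mpr hz)
  have hB0 := blaschke_zero_ne_zero hf h0 hR
  have hh0ne : h 0 ≠ 0 := hne 0 (by simpa using hR.le)
  have hPQ : blaschke hf h0 R z / blaschke hf h0 R 0 =
      (∏ u ∈ zerosIn hf h0 R, (1 - z / u) ^ analyticOrderNatAt f u) /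
        (∏ u ∈ zerosIn hf h0 R, (1 - (starRingEnd ℂ) u * z / (R : ℂ) ^ 2) ^ analyticOrderNatAt f u) := by
    rw [blaschke, blaschke, ← Finset.prod_div_distrib, ← Finset.prod_div_distrib]
    refine Finset.prod_congr rfl fun u hu => ?_
    have hu0 : u ≠ 0 := norm_pos_iff.mp (norm_pos_of_mem_zerosIn hf h0 hu)
    have huz : z ≠ u := by rintro rfl; exact hfz ((mem_zerosIn hf h0).mp hu).2
    exact canonicalFactor_zpow_div R hR hu0 huz (analyticOrderNatAt f u)
  have hQ : (∏ u ∈ zerosIn hf h0 R, (1 - (starRingEnd ℂ) u * z / (R : ℂ) ^ 2) ^ analyticOrderNatAt f u) ≠ 0 := by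
    refine Finset.prod_ne_zero_iff.mpr fun u hu => pow_ne_zero _ ?_
    exact one_sub_conj_mul_ne_zero ((mem_zerosIn hf h0).mp hu).1 hz
  have key : f z / f 0 = (∏ u ∈ zerosIn hf h0 R, (1 - z / u) ^ analyticOrderNatAt f u) /
      (∏ u ∈ zerosIn hf h0 R, (1 - (starRingEnd ℂ) u * z / (R : ℂ) ^ 2) ^ analyticOrderNatAt f u)
        * exp (φ z) := by
    rw [← hPQ, hfz', hf0', hexpz]
    field_simp
  rw [key]
  set P := ∏ u ∈ zerosIn hf h0 R, (1 - z / u) ^ analyticOrderNatAt f u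
  set Q := ∏ u ∈ zerosIn hf h0 R, (1 - (starRingEnd ℂ) u * z / (R : ℂ) ^ 2) ^ analyticOrderNatAt f u
  calc P = P / Q * Q * (exp (φ z) * exp (-φ z)) := by
        rw [← Complex.exp_add, add_neg_cancel, Complex.exp_zero, mul_one, div_mul_cancel₀ P hQ]
    _ = P / Q * exp (φ z) * Q * exp (-φ z) := by ring


/-! ### Growth of order `σ < 1`: counting bound and the limit `R → ∞` -/

/-- A product estimate: `‖∏ (1 + gᵢ)^{mᵢ} - 1‖ ≤ exp (Σ mᵢ ‖gᵢ‖) - 1`. [folklore] -/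
theorem norm_prod_pow_sub_one_le {ι : Type*} (s : Finset ι) (g : ι → ℂ) (m : ι → ℕ) :
    ‖∏ i ∈ s, (1 + g i) ^ (m i) - 1‖ ≤ Real.exp (∑ i ∈ s, (m i : ℝ) * ‖g i‖) - 1 := by
  have h1 : ∏ i ∈ s, (1 + g i) ^ (m i) = ∏ p ∈ s.sigma (fun i => Finset.range (m i)), (1 + g p.1) := by
    rw [Finset.prod_sigma]
    refine Finset.prod_congr rfl fun i _ => ?_
    simp only [Finset.prod_const, Finset.card_range]
  have h2 : ∑ i ∈ s, (m i : ℝ) * ‖g i‖ = ∑ p ∈ s.sigma (fun i => Finset.range (m i)), ‖g p.1‖ := by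
    rw [Finset.sum_sigma]
    refine Finset.sum_congr rfl fun i _ => ?_
    simp only [Finset.sum_const, Finset.card_range, nsmul_eq_mul]
  rw [h1, h2]
  exact Finset.norm_prod_one_add_sub_one_le _ _

/-- The counting bound from Jensen: `n(r) ≤ K₀ + K₁ r^σ` with `K₀ = (log C - log |f 0|)/log 2`,
`K₁ = 2 / log 2`. [folklore] -/
theorem count_le (hf : Differentiable ℂ f) (h0 : f 0 ≠ 0) {σ C : ℝ} (hσ1 : σ ≤ 1)
    (hC : 1 ≤ C) (hb : ∀ z : ℂ, ‖f z‖ ≤ C * Real.exp (‖z‖ ^ σ)) {r : ℝ} (hr : 0 < r) :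
    (count hf h0 r : ℝ) ≤ (Real.log C - Real.log ‖f 0‖) / Real.log 2 + 2 / Real.log 2 * r ^ σ := by
  have hM : (1 : ℝ) ≤ C * Real.exp ((2 * r) ^ σ) := by
    have : (1 : ℝ) ≤ Real.exp ((2 * r) ^ σ) := Real.one_le_exp (by positivity)
    nlinarith
  have h1 := count_le_of_bound hf h0 hr hM (fun z hz => by rw [← hz]; exact hb z)
  have hf0 : 0 < ‖f 0‖ := norm_pos_iff.mpr h0
  have hlog2 : 0 < Real.log 2 := Real.log_pos (by norm_num)
  have h2 : Real.log (C * Real.exp ((2 * r) ^ σ) / ‖f 0‖) =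
      Real.log C + (2 * r) ^ σ - Real.log ‖f 0‖ := by
    rw [Real.log_div (by positivity) hf0.ne', Real.log_mul (by positivity) (Real.exp_pos _).ne',
      Real.log_exp]
  rw [h2] at h1
  have h3 : (2 * r) ^ σ ≤ 2 * r ^ σ := by
    rw [Real.mul_rpow (by norm_num) hr.le]
    have : (2 : ℝ) ^ σ ≤ 2 := by
      conv_rhs => rw [← Real.rpow_one 2]
      exact Real.rpow_le_rpow_of_exponent_le (by norm_num) hσ1
    exact mul_le_mul_of_nonneg_right this (by positivity)
  calc (count hf h0 r : ℝ) ≤ (Real.log C + (2 * r) ^ σ - Real.log ‖f 0‖) / Real.log 2 := h1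
    _ ≤ (Real.log C + 2 * r ^ σ - Real.log ‖f 0‖) / Real.log 2 := by gcongr
    _ = (Real.log C - Real.log ‖f 0‖) / Real.log 2 + 2 / Real.log 2 * r ^ σ := by ring

/-- The `Q`-factor tends to `1`: `‖Q_R(z) - 1‖ ≤ exp (n(R) |z| / R) - 1`. [folklore] -/
theorem norm_Q_sub_one_le (hf : Differentiable ℂ f) (h0 : f 0 ≠ 0) {R : ℝ} (hR : 0 < R) (z : ℂ) :
    ‖(∏ u ∈ zerosIn hf h0 R, (1 - (starRingEnd ℂ) u * z / (R : ℂ) ^ 2) ^ analyticOrderNatAt f u) - 1‖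
      ≤ Real.exp (count hf h0 R * ‖z‖ / R) - 1 := by
  have h1 := norm_prod_pow_sub_one_le (zerosIn hf h0 R)
    (fun u => -((starRingEnd ℂ) u * z / (R : ℂ) ^ 2)) (analyticOrderNatAt f)
  simp only [← sub_eq_add_neg] at h1
  refine h1.trans ?_
  gcongr
  rw [count, Nat.cast_sum, Finset.sum_mul, Finset.sum_div]
  refine Finset.sum_le_sum fun u hu => ?_
  have huR : ‖u‖ ≤ R := ((mem_zerosIn hf h0).mp hu).1
  rw [norm_neg, norm_div, norm_mul, Complex.norm_conj, norm_pow, Complex.norm_real,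
    Real.norm_eq_abs, abs_of_pos hR]
  have key : ‖u‖ * ‖z‖ / R ^ 2 ≤ ‖z‖ / R := by
    rw [div_le_div_iff₀ (by positivity) hR]
    calc ‖u‖ * ‖z‖ * R ≤ R * ‖z‖ * R := by gcongr
      _ = ‖z‖ * R ^ 2 := by ring
  calc (analyticOrderNatAt f u : ℝ) * (‖u‖ * ‖z‖ / R ^ 2) ≤ (analyticOrderNatAt f u : ℝ) * (‖z‖ / R) := by gcongr
    _ = (analyticOrderNatAt f u : ℝ) * ‖z‖ / R := by ring

/-- **Pointwise convergence of the partial products** along zero-free radii `R k → ∞`: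
`∏_{|u| ≤ R_k} (1 - z/u)^{m u} → f z / f 0` (for `f z ≠ 0`) (Conway's Lemma XI.3.1 step, here via
Borel–Carathéodory). [cite: Conway1978, Ch. XI Lemma 3.1] -/
theorem tendsto_partialProduct (hf : Differentiable ℂ f) (h0 : f 0 ≠ 0) {σ C : ℝ}
    (hσ1 : σ < 1) (hC : 1 ≤ C) (hb : ∀ z : ℂ, ‖f z‖ ≤ C * Real.exp (‖z‖ ^ σ))
    (R : ℕ → ℝ) (hRpos : ∀ k, 0 < R k) (hRgood : ∀ k (u : ℂ), ‖u‖ = R k → f u ≠ 0)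
    (hRlim : Tendsto R atTop atTop) {z : ℂ} (hfz : f z ≠ 0) :
    Tendsto (fun k => ∏ u ∈ zerosIn hf h0 (R k), (1 - z / u) ^ analyticOrderNatAt f u) atTop
      (𝓝 (f z / f 0)) := by
  have hf0 : 0 < ‖f 0‖ := norm_pos_iff.mpr h0
  -- data at each radius
  have hM : ∀ k (w : ℂ), ‖w‖ = R k → ‖f w‖ ≤ C * Real.exp (R k ^ σ) := by
    intro k w hw; rw [← hw]; exact hb w
  set A : ℕ → ℝ := fun k => max (Real.log (C * Real.exp (R k ^ σ)) - Real.log ‖f 0‖) 1 with hA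
  set L : ℝ := Real.log C + |Real.log ‖f 0‖| + 1 with hL
  have hLpos : 0 < L := by
    rw [hL]; have := Real.log_nonneg hC; have := abs_nonneg (Real.log ‖f 0‖); linarith
  have hAle : ∀ k, A k ≤ L + R k ^ σ := by
    intro k
    rw [hA]
    simp only
    rw [Real.log_mul (by positivity) (Real.exp_pos _).ne', Real.log_exp]
    refine max_le ?_ ?_
    · have := neg_abs_le (Real.log ‖f 0‖); rw [hL]; linarith
    · have := abs_nonneg (Real.log ‖f 0‖); have := Real.log_nonneg hC
      have : 0 ≤ R k ^ σ := Real.rpow_nonneg (hRpos k).le σ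
      rw [hL]; linarith
  have key : ∀ k, ∃ φ : ℂ, 2 * ‖z‖ < R k →
      (‖φ‖ ≤ 2 * A k * ‖z‖ / (R k - ‖z‖) ∧
        ∏ u ∈ zerosIn hf h0 (R k), (1 - z / u) ^ analyticOrderNatAt f u =
          f z / f 0 * (∏ u ∈ zerosIn hf h0 (R k),
            (1 - (starRingEnd ℂ) u * z / (R k : ℂ) ^ 2) ^ analyticOrderNatAt f u) * exp (-φ)) := by
    intro k
    by_cases hk : 2 * ‖z‖ < R k
    · have hz : ‖z‖ < R k := by have := norm_nonneg z; linarith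
      obtain ⟨φ, h1, h2⟩ := partialProduct_eq hf h0 (hRpos k) (hRgood k) (hM k) hz hfz
      exact ⟨φ, fun _ => ⟨h1, h2⟩⟩
    · exact ⟨0, fun h => absurd h hk⟩
  choose φ hφ using key
  set Q : ℕ → ℂ := fun k => ∏ u ∈ zerosIn hf h0 (R k),
    (1 - (starRingEnd ℂ) u * z / (R k : ℂ) ^ 2) ^ analyticOrderNatAt f u with hQ
  have hev : ∀ᶠ k in atTop, 2 * ‖z‖ < R k := hRlim.eventually_gt_atTop _
  -- basic limits
  have t1 : Tendsto (fun k => (R k)⁻¹) atTop (𝓝 0) := tendsto_inv_atTop_zero.comp hRlim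
  have t2 : Tendsto (fun k => R k ^ (σ - 1)) atTop (𝓝 0) := by
    have := (tendsto_rpow_neg_atTop (by linarith : 0 < 1 - σ)).comp hRlim
    refine this.congr' (Eventually.of_forall fun k => ?_)
    simp only [Function.comp_apply]; congr 1; ring
  -- `φ k → 0`
  have hφlim : Tendsto φ atTop (𝓝 0) := by
    rw [tendsto_zero_iff_norm_tendsto_zero]
    have hbound : ∀ᶠ k in atTop, ‖φ k‖ ≤ 4 * ‖z‖ * (L * (R k)⁻¹ + R k ^ (σ - 1)) := by
      filter_upwards [hev] with k hk
      have hRk := hRpos k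
      have h1 := (hφ k hk).1
      have hApos : 0 < A k := lt_of_lt_of_le one_pos (le_max_right _ _)
      calc ‖φ k‖ ≤ 2 * A k * ‖z‖ / (R k - ‖z‖) := h1
        _ ≤ 2 * A k * ‖z‖ / (R k / 2) := by
            apply div_le_div_of_nonneg_left (by positivity) (by positivity); linarith
        _ = 4 * ‖z‖ * (A k * (R k)⁻¹) := by field_simp; ring
        _ ≤ 4 * ‖z‖ * ((L + R k ^ σ) * (R k)⁻¹) := by gcongr; exact hAle k
        _ = 4 * ‖z‖ * (L * (R k)⁻¹ + R k ^ (σ - 1)) := by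
            rw [Real.rpow_sub_one hRk.ne']; ring
    have hlim : Tendsto (fun k => 4 * ‖z‖ * (L * (R k)⁻¹ + R k ^ (σ - 1))) atTop (𝓝 0) := by
      have := ((t1.const_mul L).add t2).const_mul (4 * ‖z‖)
      simpa using this
    exact squeeze_zero' (Eventually.of_forall fun k => norm_nonneg _) hbound hlim
  -- `Q k → 1`
  have hQlim : Tendsto Q atTop (𝓝 1) := by
    rw [tendsto_iff_norm_sub_tendsto_zero]
    set K₀ := (Real.log C - Real.log ‖f 0‖) / Real.log 2 with hK₀
    set K₁ := 2 / Real.log 2 with hK₁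
    have hbound : ∀ k, ‖Q k - 1‖ ≤
        Real.exp (‖z‖ * (|K₀| * (R k)⁻¹ + K₁ * R k ^ (σ - 1))) - 1 := by
      intro k
      have hRk := hRpos k
      refine (norm_Q_sub_one_le hf h0 hRk z).trans ?_
      gcongr
      have hc := count_le hf h0 hσ1.le hC hb hRk
      calc (count hf h0 (R k) : ℝ) * ‖z‖ / R k = ‖z‖ * ((count hf h0 (R k) : ℝ) * (R k)⁻¹) := by
            field_simp
        _ ≤ ‖z‖ * ((|K₀| + K₁ * R k ^ σ) * (R k)⁻¹) := by
            gcongr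
            exact hc.trans (by have := le_abs_self K₀; linarith)
        _ = ‖z‖ * (|K₀| * (R k)⁻¹ + K₁ * R k ^ (σ - 1)) := by
            rw [Real.rpow_sub_one hRk.ne']; ring
    have hlim : Tendsto (fun k => Real.exp (‖z‖ * (|K₀| * (R k)⁻¹ + K₁ * R k ^ (σ - 1))) - 1)
        atTop (𝓝 0) := by
      have h1 : Tendsto (fun k => ‖z‖ * (|K₀| * (R k)⁻¹ + K₁ * R k ^ (σ - 1))) atTop (𝓝 0) := by
        have := ((t1.const_mul |K₀|).add (t2.const_mul K₁)).const_mul ‖z‖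
        simpa using this
      have h2 := (Real.continuous_exp.tendsto 0).comp h1
      rw [Real.exp_zero] at h2
      have h3 := h2.sub_const 1
      simpa using h3
    exact squeeze_zero' (Eventually.of_forall fun k => norm_nonneg _)
      (Eventually.of_forall hbound) hlim
  -- conclusion
  have hexp : Tendsto (fun k => exp (-φ k)) atTop (𝓝 1) := by
    have h1 : Tendsto (fun k => -φ k) atTop (𝓝 0) := by simpa using hφlim.neg
    have := (Complex.continuous_exp.tendsto 0).comp h1
    simpa [Function.comp_def] using this
  have hprod : Tendsto (fun k => f z / f 0 * Q k * exp (-φ k)) atTop (𝓝 (f z / f 0)) := by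
    have := (hQlim.const_mul (f z / f 0)).mul hexp
    simpa using this
  refine hprod.congr' ?_
  filter_upwards [hev] with k hk
  exact ((hφ k hk).2).symm


/-! ### Convergence exponent: `Σ m(u)/|u|` is bounded -/

/-- `W(R) = Σ_{|u| ≤ R} m(u)/|u|`. [folklore] -/
def wsum (hf : Differentiable ℂ f) (h0 : f 0 ≠ 0) (R : ℝ) : ℝ :=
  ∑ u ∈ zerosIn hf h0 R, (analyticOrderNatAt f u : ℝ) / ‖u‖

/-- The weighted zero sum `∑_{|a| ≤ R} (analyticOrderNatAt f a)/|a|` is monotone in `R`. [folklore] -/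
theorem wsum_mono (hf : Differentiable ℂ f) (h0 : f 0 ≠ 0) {R R' : ℝ} (h : R ≤ R') :
    wsum hf h0 R ≤ wsum hf h0 R' :=
  Finset.sum_le_sum_of_subset_of_nonneg (zerosIn_mono hf h0 h) fun _ _ _ => by positivity

/-- Dyadic step: `wsum(2R) − wsum(R) ≤ n(2R)/R`. [folklore] -/
theorem wsum_two_mul_le (hf : Differentiable ℂ f) (h0 : f 0 ≠ 0) {R : ℝ} (hR : 0 < R) :
    wsum hf h0 (2 * R) ≤ wsum hf h0 R + count hf h0 (2 * R) / R := by
  unfold wsum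
  rw [← Finset.sum_filter_add_sum_filter_not (zerosIn hf h0 (2 * R)) (fun u => ‖u‖ ≤ R)]
  have h1 : (zerosIn hf h0 (2 * R)).filter (fun u => ‖u‖ ≤ R) = zerosIn hf h0 R := by
    ext u
    simp only [Finset.mem_filter, mem_zerosIn]
    constructor
    · rintro ⟨⟨_, h⟩, h'⟩; exact ⟨h', h⟩
    · rintro ⟨h, h'⟩; exact ⟨⟨by linarith, h'⟩, h⟩
  rw [h1]
  gcongr
  rw [count, Nat.cast_sum, Finset.sum_div]
  calc ∑ u ∈ (zerosIn hf h0 (2 * R)).filter (fun u => ¬‖u‖ ≤ R), (analyticOrderNatAt f u : ℝ) / ‖u‖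
      ≤ ∑ u ∈ (zerosIn hf h0 (2 * R)).filter (fun u => ¬‖u‖ ≤ R), (analyticOrderNatAt f u : ℝ) / R := by
        refine Finset.sum_le_sum fun u hu => ?_
        rw [Finset.mem_filter, not_le] at hu
        exact div_le_div_of_nonneg_left (by positivity) hR hu.2.le
    _ ≤ ∑ u ∈ zerosIn hf h0 (2 * R), (analyticOrderNatAt f u : ℝ) / R :=
        Finset.sum_le_sum_of_subset_of_nonneg (Finset.filter_subset _ _)
          fun _ _ _ => by positivity

/-- Dyadic bound for `wsum(2^K)`. [folklore] -/
theorem wsum_two_pow_le (hf : Differentiable ℂ f) (h0 : f 0 ≠ 0) (K : ℕ) :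
    wsum hf h0 (2 ^ K) ≤ wsum hf h0 1 +
      ∑ k ∈ Finset.range K, (count hf h0 (2 ^ (k + 1)) : ℝ) / 2 ^ k := by
  induction K with
  | zero => simp
  | succ K ih =>
    rw [Finset.sum_range_succ, pow_succ, mul_comm]
    have := wsum_two_mul_le hf h0 (R := 2 ^ K) (by positivity)
    rw [show (2 : ℝ) * 2 ^ K = 2 ^ (K + 1) by ring] at this ⊢
    linarith

/-- With growth of order `σ < 1`, `W(R)` is bounded (dyadic decomposition + Jensen). [folklore] -/
theorem wsum_le (hf : Differentiable ℂ f) (h0 : f 0 ≠ 0) {σ C : ℝ} (hσ1 : σ < 1) (hC : 1 ≤ C)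
    (hb : ∀ z : ℂ, ‖f z‖ ≤ C * Real.exp (‖z‖ ^ σ)) :
    ∃ c : ℝ, ∀ R : ℝ, wsum hf h0 R ≤ c := by
  set K₀ := (Real.log C - Real.log ‖f 0‖) / Real.log 2 with hK₀
  set K₁ := 2 / Real.log 2 with hK₁
  have hK₁ : 0 ≤ K₁ := by rw [hK₁]; have := Real.log_pos (by norm_num : (1 : ℝ) < 2); positivity
  set q : ℝ := (2 : ℝ) ^ (σ - 1) with hq
  have hq0 : 0 < q := Real.rpow_pos_of_pos (by norm_num) _
  have hq1 : q < 1 := Real.rpow_lt_one_of_one_lt_of_neg (by norm_num) (by linarith)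
  -- termwise bound
  have hterm : ∀ k : ℕ, (count hf h0 (2 ^ (k + 1)) : ℝ) / 2 ^ k ≤
      |K₀| * (1 / 2) ^ k + K₁ * (2 : ℝ) ^ σ * q ^ k := by
    intro k
    have hc := count_le hf h0 hσ1.le hC hb (r := 2 ^ (k + 1)) (by positivity)
    have h1 : ((2 : ℝ) ^ (k + 1)) ^ σ = (2 : ℝ) ^ σ * q ^ k * 2 ^ k := by
      rw [hq, ← Real.rpow_natCast 2 (k + 1), ← Real.rpow_mul (by norm_num),
        ← Real.rpow_natCast q k, hq, ← Real.rpow_mul (by norm_num), ← Real.rpow_natCast 2 k,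
        ← Real.rpow_add (by norm_num), ← Real.rpow_add (by norm_num)]
      congr 1; push_cast; ring
    rw [h1] at hc
    rw [div_le_iff₀ (by positivity)]
    calc (count hf h0 (2 ^ (k + 1)) : ℝ) ≤ K₀ + K₁ * ((2 : ℝ) ^ σ * q ^ k * 2 ^ k) := hc
      _ ≤ |K₀| * 1 + K₁ * ((2 : ℝ) ^ σ * q ^ k * 2 ^ k) := by
          have := le_abs_self K₀; linarith
      _ ≤ |K₀| * ((1 / 2) ^ k * 2 ^ k) + K₁ * ((2 : ℝ) ^ σ * q ^ k * 2 ^ k) := by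
          rw [← mul_pow]; norm_num
      _ = (|K₀| * (1 / 2) ^ k + K₁ * (2 : ℝ) ^ σ * q ^ k) * 2 ^ k := by ring
  refine ⟨wsum hf h0 1 + (|K₀| * 2 + K₁ * (2 : ℝ) ^ σ / (1 - q)), fun R => ?_⟩
  obtain ⟨K, hK⟩ := pow_unbounded_of_one_lt R (by norm_num : (1 : ℝ) < 2)
  refine (wsum_mono hf h0 hK.le).trans ((wsum_two_pow_le hf h0 K).trans ?_)
  gcongr
  calc ∑ k ∈ Finset.range K, (count hf h0 (2 ^ (k + 1)) : ℝ) / 2 ^ k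
      ≤ ∑ k ∈ Finset.range K, (|K₀| * (1 / 2) ^ k + K₁ * (2 : ℝ) ^ σ * q ^ k) :=
        Finset.sum_le_sum fun k _ => hterm k
    _ = |K₀| * ∑ k ∈ Finset.range K, (1 / 2 : ℝ) ^ k +
          K₁ * (2 : ℝ) ^ σ * ∑ k ∈ Finset.range K, q ^ k := by
        rw [Finset.sum_add_distrib, Finset.mul_sum, Finset.mul_sum]
    _ ≤ |K₀| * 2 + K₁ * (2 : ℝ) ^ σ / (1 - q) := by
        have h1 : ∑ k ∈ Finset.range K, (1 / 2 : ℝ) ^ k ≤ 2 := by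
          have := geom_sum_Ico_le_of_lt_one (x := (1 / 2 : ℝ)) (by norm_num) (by norm_num)
            (m := 0) (n := K)
          rw [← Finset.range_eq_Ico] at this
          refine this.trans ?_; norm_num
        have h2 : ∑ k ∈ Finset.range K, q ^ k ≤ 1 / (1 - q) := by
          have := geom_sum_Ico_le_of_lt_one hq0.le hq1 (m := 0) (n := K)
          rw [← Finset.range_eq_Ico, pow_zero] at this
          exact this
        have h3 : 0 ≤ K₁ * (2 : ℝ) ^ σ := by positivity
        calc |K₀| * ∑ k ∈ Finset.range K, (1 / 2 : ℝ) ^ k +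
              K₁ * (2 : ℝ) ^ σ * ∑ k ∈ Finset.range K, q ^ k
            ≤ |K₀| * 2 + K₁ * (2 : ℝ) ^ σ * (1 / (1 - q)) := by gcongr
          _ = |K₀| * 2 + K₁ * (2 : ℝ) ^ σ / (1 - q) := by ring


/-! ### The zeros with multiplicity as an indexed family -/

/-- Index type for the zeros of `f` repeated with multiplicity: pairs `(u, j)` with `f u = 0`,
`j < m(u)`. [folklore] -/
abbrev ZIdx (f : ℂ → ℂ) : Type := {p : ℂ × ℕ // f p.1 = 0 ∧ p.2 < analyticOrderNatAt f p.1}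

/-- The zero attached to an index. [folklore] -/
def ZIdx.pt {f : ℂ → ℂ} (i : ZIdx f) : ℂ := i.1.1

/-- The point of a zero index is a zero of `f`. [folklore] -/
theorem ZIdx.f_pt {f : ℂ → ℂ} (i : ZIdx f) : f i.pt = 0 := i.2.1

/-- The index set of zeros-with-multiplicity is countable. [folklore] -/
theorem countable_ZIdx (hf : Differentiable ℂ f) (h0 : f 0 ≠ 0) : Countable (ZIdx f) := by
  have hZ : {u : ℂ | f u = 0}.Countable := by
    have : {u : ℂ | f u = 0} ⊆ ⋃ n : ℕ, (zerosIn hf h0 ((n : ℕ) : ℝ) : Set ℂ) := by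
      intro u hu
      obtain ⟨n, hn⟩ := exists_nat_ge ‖u‖
      refine mem_iUnion.mpr ⟨n, ?_⟩
      rw [Finset.mem_coe, mem_zerosIn]
      exact ⟨hn, hu⟩
    exact (countable_iUnion (ι := ℕ)
      fun n => (zerosIn hf h0 ((n : ℕ) : ℝ)).finite_toSet.countable).mono this
  have h2 : {p : ℂ × ℕ | f p.1 = 0 ∧ p.2 < analyticOrderNatAt f p.1}.Countable :=
    (hZ.prod (countable_univ (α := ℕ))).mono fun p hp => Set.mk_mem_prod hp.1 (mem_univ _)
  exact h2.to_subtype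

/-- Zero indices point away from `0`. [folklore] -/
theorem ZIdx.pt_ne_zero (h0 : f 0 ≠ 0) (i : ZIdx f) : i.pt ≠ 0 := by
  intro h; exact h0 (h ▸ i.f_pt)

/-- The indices with `|u| ≤ R`, as a `Finset`. [folklore] -/
def idxIn (hf : Differentiable ℂ f) (h0 : f 0 ≠ 0) (R : ℝ) : Finset (ZIdx f) :=
  ((zerosIn hf h0 R).sigma (fun u => Finset.range (analyticOrderNatAt f u))).attach.map
    ⟨fun p => ⟨(p.1.1, p.1.2), by
        have hp := Finset.mem_sigma.mp p.2
        exact ⟨((mem_zerosIn hf h0).mp hp.1).2, Finset.mem_range.mp hp.2⟩⟩,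
     by
        intro p q hpq
        have h := congrArg Subtype.val hpq
        simp only [Prod.mk.injEq] at h
        apply Subtype.ext
        exact Sigma.ext h.1 (heq_of_eq h.2)⟩

/-- Membership in the finite index set of zeros of norm `≤ R`. [folklore] -/
theorem mem_idxIn (hf : Differentiable ℂ f) (h0 : f 0 ≠ 0) {R : ℝ} {i : ZIdx f} :
    i ∈ idxIn hf h0 R ↔ ‖i.pt‖ ≤ R := by
  constructor
  · intro hi
    rw [idxIn, Finset.mem_map] at hi
    obtain ⟨p, _, rfl⟩ := hi
    have hp := Finset.mem_sigma.mp p.2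
    exact ((mem_zerosIn hf h0).mp hp.1).1
  · intro hi
    rw [idxIn, Finset.mem_map]
    have hmem : (⟨i.1.1, i.1.2⟩ : (_ : ℂ) × ℕ) ∈
        (zerosIn hf h0 R).sigma (fun u => Finset.range (analyticOrderNatAt f u)) :=
      Finset.mem_sigma.mpr ⟨(mem_zerosIn hf h0).mpr ⟨hi, i.2.1⟩, Finset.mem_range.mpr i.2.2⟩
    exact ⟨⟨_, hmem⟩, Finset.mem_attach _ _, rfl⟩

/-- `idxIn` is monotone in `R`. [folklore] -/
theorem idxIn_mono (hf : Differentiable ℂ f) (h0 : f 0 ≠ 0) {R R' : ℝ} (h : R ≤ R') :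
    idxIn hf h0 R ⊆ idxIn hf h0 R' := fun _ hi =>
  (mem_idxIn hf h0).mpr (((mem_idxIn hf h0).mp hi).trans h)

/-- Products over zero indices of norm `≤ R` = products over `zerosIn` with multiplicity. [folklore] -/
theorem prod_idxIn (hf : Differentiable ℂ f) (h0 : f 0 ≠ 0) (R : ℝ) (g : ℂ → ℂ) :
    ∏ i ∈ idxIn hf h0 R, g i.pt = ∏ u ∈ zerosIn hf h0 R, g u ^ analyticOrderNatAt f u := by
  rw [idxIn, Finset.prod_map]
  show ∏ x ∈ ((zerosIn hf h0 R).sigma (fun u => Finset.range (analyticOrderNatAt f u))).attach,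
      (fun p : (_ : ℂ) × ℕ => g p.1) x.1 = _
  rw [Finset.prod_attach _ (fun p : (_ : ℂ) × ℕ => g p.1), Finset.prod_sigma]
  refine Finset.prod_congr rfl fun u _ => ?_
  simp

/-- Sums over zero indices of norm `≤ R` = weighted sums over `zerosIn`. [folklore] -/
theorem sum_idxIn (hf : Differentiable ℂ f) (h0 : f 0 ≠ 0) (R : ℝ) (g : ℂ → ℝ) :
    ∑ i ∈ idxIn hf h0 R, g i.pt = ∑ u ∈ zerosIn hf h0 R, (analyticOrderNatAt f u : ℝ) * g u := by
  rw [idxIn, Finset.sum_map]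
  show ∑ x ∈ ((zerosIn hf h0 R).sigma (fun u => Finset.range (analyticOrderNatAt f u))).attach,
      (fun p : (_ : ℂ) × ℕ => g p.1) x.1 = _
  rw [Finset.sum_attach _ (fun p : (_ : ℂ) × ℕ => g p.1), Finset.sum_sigma]
  refine Finset.sum_congr rfl fun u _ => ?_
  simp

/-- Every finite set of zero indices lies in some `idxIn f R`. [folklore] -/
theorem subset_idxIn (hf : Differentiable ℂ f) (h0 : f 0 ≠ 0) (s : Finset (ZIdx f)) :
    s ⊆ idxIn hf h0 (∑ i ∈ s, ‖i.pt‖) := fun _ hi =>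
  (mem_idxIn hf h0).mpr (Finset.single_le_sum (fun j _ => norm_nonneg j.pt) hi)

/-! ### The main theorem (normalised growth hypothesis) -/

/-- **Hadamard, genus zero** (core statement, zeros indexed by `ZIdx f`): for `f` entire with
`‖f z‖ ≤ C exp (‖z‖^σ)`, `σ < 1`, `C ≥ 1`, `f 0 ≠ 0`, the inverse moduli of the zeros are summable
and `f z / f 0 = ∏ (1 - z/u)` over the zeros with multiplicity (unconditional convergence).
[cite: Conway1978, Ch. XI Thm. 3.4] -/
theorem hadamard_core (hf : Differentiable ℂ f) (h0 : f 0 ≠ 0) {σ C : ℝ} (hσ1 : σ < 1)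
    (hC : 1 ≤ C) (hb : ∀ z : ℂ, ‖f z‖ ≤ C * Real.exp (‖z‖ ^ σ)) :
    (Summable fun i : ZIdx f => ‖i.pt‖⁻¹) ∧
      ∀ z : ℂ, HasProd (fun i : ZIdx f => 1 - z / i.pt) (f z / f 0) := by
  obtain ⟨c, hc⟩ := wsum_le hf h0 hσ1 hC hb
  have hsum : Summable fun i : ZIdx f => ‖i.pt‖⁻¹ := by
    refine summable_of_sum_le (fun i => by positivity) (c := c) fun s => ?_
    calc ∑ i ∈ s, ‖i.pt‖⁻¹ ≤ ∑ j ∈ idxIn hf h0 (∑ i ∈ s, ‖i.pt‖), ‖j.pt‖⁻¹ :=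
          Finset.sum_le_sum_of_subset_of_nonneg (subset_idxIn hf h0 s) fun _ _ _ => by positivity
      _ = wsum hf h0 (∑ i ∈ s, ‖i.pt‖) := by
          rw [sum_idxIn hf h0 _ (fun u => ‖u‖⁻¹), wsum]
          simp [div_eq_mul_inv]
      _ ≤ c := hc _
  refine ⟨hsum, fun z => ?_⟩
  by_cases hfz : f z = 0
  · -- `z` is a zero: the family contains the factor `0`
    have hz0 : z ≠ 0 := fun h => h0 (h ▸ hfz)
    let i₀ : ZIdx f := ⟨(z, 0), hfz, Nat.pos_of_ne_zero ((analyticOrderNatAt_ne_zero_iff hf h0 z).mpr hfz)⟩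
    have hi₀ : (1 - z / i₀.pt) = 0 := by
      show 1 - z / z = 0
      rw [div_self hz0, sub_self]
    rw [hfz, zero_div]
    show Tendsto (fun s : Finset (ZIdx f) => ∏ i ∈ s, (1 - z / i.pt)) atTop (𝓝 0)
    refine tendsto_const_nhds.congr' ?_
    rw [EventuallyEq, eventually_atTop]
    exact ⟨{i₀}, fun s hs => (Finset.prod_eq_zero (hs (Finset.mem_singleton_self i₀)) hi₀).symm⟩
  · -- `f z ≠ 0`: compare the unconditional product with the partial products over balls
    have hmult : Multipliable fun i : ZIdx f => 1 - z / i.pt := by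
      have h1 : Summable fun i : ZIdx f => ‖-(z / i.pt)‖ := by
        have := hsum.mul_left ‖z‖
        refine this.congr fun i => ?_
        rw [norm_neg, norm_div, div_eq_mul_inv]
      have := multipliable_one_add_of_summable h1
      simpa [sub_eq_add_neg] using this
    -- zero-free radii `4^k ≤ R k ≤ 2 · 4^k`
    choose R hR using fun k : ℕ => exists_good_radius hf h0 (R₀ := (4 : ℝ) ^ k) (by positivity)
    have hRpos : ∀ k, 0 < R k := fun k => lt_of_lt_of_le (by positivity) (hR k).1
    have hRlim : Tendsto R atTop atTop :=
      tendsto_atTop_mono (fun k => (hR k).1) (tendsto_pow_atTop_atTop_of_one_lt (by norm_num))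
    have hRmono : Monotone R := by
      refine monotone_nat_of_le_succ fun k => ?_
      calc R k ≤ 2 * 4 ^ k := (hR k).2.1
        _ ≤ 4 ^ (k + 1) := by rw [pow_succ]; nlinarith [pow_pos (by norm_num : (0:ℝ) < 4) k]
        _ ≤ R (k + 1) := (hR (k + 1)).1
    have T1 : Tendsto (fun k => ∏ i ∈ idxIn hf h0 (R k), (1 - z / i.pt)) atTop
        (𝓝 (f z / f 0)) := by
      have := tendsto_partialProduct hf h0 hσ1 hC hb R hRpos (fun k => (hR k).2.2) hRlim hfz
      refine this.congr fun k => ?_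
      exact (prod_idxIn hf h0 (R k) (fun u => 1 - z / u)).symm
    have hS : Tendsto (fun k => idxIn hf h0 (R k)) atTop atTop := by
      refine tendsto_atTop_atTop.mpr fun s => ?_
      obtain ⟨k₀, hk₀⟩ := (hRlim.eventually_ge_atTop (∑ i ∈ s, ‖i.pt‖)).exists
      refine ⟨k₀, fun k hk => ?_⟩
      exact (subset_idxIn hf h0 s).trans (idxIn_mono hf h0 (hk₀.trans (hRmono hk)))
    have T2 : Tendsto (fun k => ∏ i ∈ idxIn hf h0 (R k), (1 - z / i.pt)) atTop
        (𝓝 (∏' i : ZIdx f, (1 - z / i.pt))) := hmult.hasProd.comp hS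
    have := tendsto_nhds_unique T2 T1
    rw [← this]
    exact hmult.hasProd


/-- Normalisation of the growth hypothesis: from `‖f z‖ ≤ C exp (‖z‖^ρ)` (`ρ < 1`, any `C`) to
`‖f z‖ ≤ C' exp (‖z‖^σ)` with `σ = max ρ (1/2) ∈ (0, 1)` and `C' ≥ 1`. [folklore] -/
theorem growth_normalise (hf : Differentiable ℂ f) {ρ C : ℝ} (hρ : ρ < 1)
    (hb : ∀ z : ℂ, ‖f z‖ ≤ C * Real.exp (‖z‖ ^ ρ)) :
    ∃ σ C' : ℝ, σ < 1 ∧ 1 ≤ C' ∧ ∀ z : ℂ, ‖f z‖ ≤ C' * Real.exp (‖z‖ ^ σ) := by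
  obtain ⟨M₀, hM₀⟩ := (isCompact_closedBall (0 : ℂ) 1).exists_bound_of_continuousOn
    hf.continuous.continuousOn
  refine ⟨max ρ (1 / 2), max (max |C| 1) M₀, max_lt hρ (by norm_num),
    le_trans (le_max_right _ _) (le_max_left _ _), fun z => ?_⟩
  by_cases hz : ‖z‖ ≤ 1
  · calc ‖f z‖ ≤ M₀ := hM₀ z (mem_closedBall_zero_iff.mpr hz)
      _ ≤ M₀ * Real.exp (‖z‖ ^ max ρ (1 / 2)) := by
          have hM : 0 ≤ M₀ := (norm_nonneg _).trans (hM₀ 0 (by simp))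
          have : 1 ≤ Real.exp (‖z‖ ^ max ρ (1 / 2)) := Real.one_le_exp (by positivity)
          nlinarith
      _ ≤ max (max |C| 1) M₀ * Real.exp (‖z‖ ^ max ρ (1 / 2)) := by
          gcongr; exact le_max_right _ _
  · rw [not_le] at hz
    calc ‖f z‖ ≤ C * Real.exp (‖z‖ ^ ρ) := hb z
      _ ≤ |C| * Real.exp (‖z‖ ^ ρ) := by gcongr; exact le_abs_self C
      _ ≤ |C| * Real.exp (‖z‖ ^ max ρ (1 / 2)) := by
          apply mul_le_mul_of_nonneg_left _ (abs_nonneg C)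
          exact Real.exp_le_exp.mpr (Real.rpow_le_rpow_of_exponent_le hz.le (le_max_left _ _))
      _ ≤ max (max |C| 1) M₀ * Real.exp (‖z‖ ^ max ρ (1 / 2)) := by
          gcongr; exact le_trans (le_max_left _ _) (le_max_left _ _)

/-- The fibre of `ZIdx.pt` over a zero `a` has `analyticOrderNatAt f a` elements. [folklore] -/
theorem ncard_fibre (hf : Differentiable ℂ f) (h0 : f 0 ≠ 0) (a : ℂ) :
    {i : ZIdx f | i.pt = a}.ncard = analyticOrderNatAt f a := by
  by_cases ha : f a = 0
  · have : {i : ZIdx f | i.pt = a} =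
        range (fun j : Fin (analyticOrderNatAt f a) => (⟨(a, (j : ℕ)), ha, j.2⟩ : ZIdx f)) := by
      ext i
      simp only [mem_setOf_eq, mem_range]
      constructor
      · intro hi
        refine ⟨⟨i.1.2, hi ▸ i.2.2⟩, ?_⟩
        apply Subtype.ext
        simp only
        exact Prod.ext hi.symm rfl
      · rintro ⟨j, rfl⟩; rfl
    rw [this, Set.ncard_range_of_injective, Nat.card_eq_fintype_card, Fintype.card_fin]
    intro j j' hjj'
    have := congrArg (fun i : ZIdx f => i.1.2) hjj'
    exact Fin.ext this
  · have h1 : {i : ZIdx f | i.pt = a} = ∅ := by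
      ext i
      simp only [mem_setOf_eq, mem_empty_iff_false, iff_false]
      intro hi; exact ha (hi ▸ i.f_pt)
    rw [h1, Set.ncard_empty, eq_comm]
    exact (analyticOrderNatAt_eq_zero_iff hf h0 a).mpr ha

end HadamardGenusZero

open HadamardGenusZero in
/-- **Hadamard's factorisation theorem in genus zero, strong form.** If `f` is entire,
`‖f z‖ ≤ C exp (‖z‖^ρ)` for some `ρ < 1`, and `f 0 ≠ 0`, then there is a sequence `b : ℕ → ℂ` with
`Σ ‖bₙ‖ < ∞` and `f z / f 0 = ∏ₙ (1 - bₙ z)` (unconditionally) for every `z`; the non-zero `bₙ`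
are inverses of zeros of `f`, and for every `a ≠ 0` exactly `analyticOrderAt f a` indices `n`
have `bₙ = a⁻¹` (`analyticOrderNatAt f a`; so the `bₙ` are the inverses of the zeros repeated with
multiplicity, padded with zeros). [cite: Conway1978, Ch. XI Thm. 3.4] -/
theorem hadamard_genus_zero_zeros (f : ℂ → ℂ) (ρ C : ℝ) (hf : Differentiable ℂ f) (hρ : ρ < 1)
    (hb : ∀ z : ℂ, ‖f z‖ ≤ C * Real.exp (‖z‖ ^ ρ)) (h0 : f 0 ≠ 0) :
    ∃ b : ℕ → ℂ, Summable (fun n => ‖b n‖) ∧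
      (∀ n, b n ≠ 0 → f (b n)⁻¹ = 0) ∧
      (∀ a : ℂ, a ≠ 0 → {n : ℕ | b n = a⁻¹}.ncard = analyticOrderNatAt f a) ∧
      ∀ z : ℂ, HasProd (fun n => 1 - b n * z) (f z / f 0) := by
  obtain ⟨σ, C', hσ1, hC', hb'⟩ := growth_normalise hf hρ hb
  obtain ⟨hsum, hprod⟩ := hadamard_core hf h0 hσ1 hC' hb'
  haveI := countable_ZIdx hf h0
  obtain ⟨e, he⟩ := Countable.exists_injective_nat (ZIdx f)
  set b : ℕ → ℂ := Function.extend e (fun i => (i.pt)⁻¹) 0 with hb_def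
  have hbe : ∀ i, b (e i) = (i.pt)⁻¹ := fun i => he.extend_apply _ _ i
  have hbn : ∀ n, n ∉ range e → b n = 0 := by
    intro n hn
    rw [hb_def, Function.extend_apply' _ _ _ (by simpa using hn)]
    rfl
  refine ⟨b, ?_, ?_, ?_, ?_⟩
  · refine (he.summable_iff (f := fun n => ‖b n‖) fun n hn => by simp [hbn n hn]).mp ?_
    refine hsum.congr fun i => ?_
    simp [Function.comp_apply, hbe]
  · intro n hn
    by_cases h : n ∈ range e
    · obtain ⟨i, rfl⟩ := h
      rw [hbe, inv_inv]; exact i.f_pt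
    · exact absurd (hbn n h) hn
  · intro a ha
    have hset : {n : ℕ | b n = a⁻¹} = e '' {i : ZIdx f | i.pt = a} := by
      ext n
      simp only [mem_setOf_eq, mem_image]
      constructor
      · intro hn
        have hn0 : b n ≠ 0 := by rw [hn]; exact inv_ne_zero ha
        by_cases h : n ∈ range e
        · obtain ⟨i, rfl⟩ := h
          refine ⟨i, ?_, rfl⟩
          rw [hbe] at hn
          exact inv_injective hn
        · exact absurd (hbn n h) hn0
      · rintro ⟨i, hi, rfl⟩
        rw [hbe, hi]
    rw [hset, Set.ncard_image_of_injective _ he, ncard_fibre hf h0 a]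
  · intro z
    have h1 : ∀ n, n ∉ range e → 1 - b n * z = 1 := fun n hn => by simp [hbn n hn]
    refine (he.hasProd_iff (f := fun n => 1 - b n * z) h1).mp ?_
    have : ((fun n => 1 - b n * z) ∘ e) = fun i : ZIdx f => 1 - z / i.pt := by
      funext i
      simp only [Function.comp_apply, hbe]
      rw [div_eq_mul_inv, mul_comm]
    rw [this]
    exact hprod z

/-- Discharge of the named fact `Literature.Analysis.Complex.hadamard_genus_zero`
[cite: Conway1978, Ch. XI Thm. 3.4]. -/
theorem hadamard_genus_zero_holds : hadamard_genus_zero := by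
  intro f ρ C hf hρ hb h0
  obtain ⟨b, h1, -, -, h4⟩ := hadamard_genus_zero_zeros f ρ C hf hρ hb h0
  exact ⟨b, h1, h4⟩

end Literature.Analysis.Complex
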